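import Literature.AlgebraicGeometry.Resolution.CanonicalResolution
import HarnessLib

/-!
# Pull-backs of multiple blow-ups along arbitrary morphisms; extensions (BGMW 2011, Def. 3.1.5, Thm. 8.0.5 (1)–(2))

Topic: `Literature/AlgebraicGeometry/Resolution`. DEFINITIONS (with unfolding API and the
structural calculus proved) for the decomposition of the named fact
`BierstoneGrigorievMilmanWlodarczyk2011_canonical` (`CanonicalResolution.lean`; Bierstone–
Grigoriev–Milman–Włodarczyk, arXiv:1206.3090, Thm. 8.0.5): its functoriality clauses read

  "(1) For any surjective étale morphism `φ : X' → X`, the induced sequence `(X'_i) = φ^*(X_i)`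
  is the canonical resolution of `φ^*(X, 𝓘, E, μ)`. (2) For any étale morphism `φ : M' → M`, the
  induced sequence `(X'_i) = φ^*(X_i)` is an extension of the canonical resolution of
  `φ^*(X, 𝓘, E, μ)`" (Thm. 4.0.6 / Thm. 8.0.5, pp. 11 and 23),

  "Definition 3.1.5. An extension of a multiple blow-up (or a resolution) `(X_i)_{0≤i≤m}` is a
  sequence `(X'_j)_{0≤j≤m'}` of blow-ups and isomorphisms
  `X'_0 = X'_{j_0} = … = X'_{j_1-1} ← X'_{j_1} = … = X'_{j_2-1} ← … X'_{j_m} = … = X'_{m'}`, where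
  `X'_{j_i} = X_i`" (p. 6),

and the data-level multiple blow-ups of the tree (`CentreSeq`, `BlowupSequences.lean`) so far
have the induced sequence only along OPEN IMMERSIONS (`CentreSeq.restrict`) and the extension
relation only against a ONE-STEP sequence (`CentreSeq.IsExtensionOfSingle`,
`CanonicalResolution.lean`). This file supplies the general notions:

* `blowup.comapMap C f : Bl_{f^*C}(U) ⟶ Bl_C(X)` — the morphism induced on blow-ups by ANY
  morphism `f : U ⟶ X` (universal property, Görtz–Wedhorn I, Prop. 13.91 (1): it exists as soon
  as `f^*C` pulls back to an effective Cartier divisor on `Bl_{f^*C}(U)`, which it does);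
  `comapMap_π`; `blowup.map C j = blowup.comapMap C j` for open immersions (`rfl`).
* `CentreSeq.comap s f` — **the induced sequence `f^*(X_i)`** along any `f` (BGMW Thm. 8.0.5:
  `φ^*(X_i)` for étale `φ`): centres pulled back, the rest pulled back along `comapMap`;
  `restrict_eq_comap` (agrees with `restrict` on open immersions).
* `CentreSeq.IsPullbackAlong f s s'` — the same as a RELATION ("`s'` is the sequence induced
  from `s` along `f`": heads `C' = f^*C` and the tails related along some (the) morphism of
  blow-ups over `f`), which composes without transport of dependent types:
  `isPullbackAlong_comap` (existence), `IsPullbackAlong.unique`, `IsPullbackAlong.comp`,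
  `isPullbackAlong_id`; whence `comap_comp : s^*(g ≫ f) = (s^*f)^*g` and `comap_id`.
* `CentreSeq.IsExtensionOf s t` — **BGMW Def. 3.1.5 in general**: `s` is obtained from `t` by
  interspersing trivial steps (blow-ups along the unit ideal, i.e. isomorphisms, Def. 3.1.4;
  after such a step the remaining comparison is with `t` pulled back along the isomorphism
  `Bl_∅(X) → X`); `IsExtensionOf.refl`, `isExtensionOf_nil_iff` (`↔ AllTrivial`),
  **`isExtensionOf_single_iff`** (`s.IsExtensionOf (single J) ↔ s.IsExtensionOfSingle J`:
  consistency with the clause of the named fact), **`IsExtensionOf.comap`** (extensions pull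
  back to extensions along any morphism — Def. 3.1.5 Remark (1) "arises naturally when we pass
  to open subsets"), `IsExtensionOf.restrict`, **`IsExtensionOf.trans`**, and
  `IsExtensionOf.isExtensionOfSingle` (an extension of an extension of the one-step sequence
  along `J` is an extension of it — the composition used to read clause (ii) of the fact from
  Thm. 8.0.5 (2) and the value of the canonical resolution on a smooth centre).

## Sources

* E. Bierstone, D. Grigoriev, P. Milman, J. Włodarczyk, arXiv:1206.3090 (arXiv numbering):
  Defs. 3.1.4–3.1.5 and Remark (1) (p. 6); Thm. 4.0.6 (1)–(2) (p. 11); Thm. 8.0.5 (1)–(2)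
  (p. 23). [BierstoneGrigorievMilmanWlodarczyk2011]
* U. Görtz, T. Wedhorn, *Algebraic Geometry I*, 2nd ed. (2020), Def. 13.90, Prop. 13.91 (1).
  [GortzWedhorn2020]

## Design notes

* `IsExtensionOf` is defined by recursion on the extending sequence `s`; a step of `s` either
  IS the next step of `t` (same centre, literally: `t = cons C rest'`) or is trivial (`C = ⊤`),
  in which case `t` is carried along the isomorphism `blowup.π ⊤` by `comap`. Isomorphism
  steps other than empty blow-ups (e.g. blow-ups of divisors, which change the marked ideal)
  are NOT trivial steps, as in `IsExtensionOfSingle`.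
* Equalities of sequences induced along composites are obtained from the uniqueness of
  `IsPullbackAlong` (whose proof substitutes pattern variables), never by rewriting the type
  of a tail.
-/

noncomputable section

open CategoryTheory CategoryTheory.Limits AlgebraicGeometry TopologicalSpace Topology

namespace Literature.AlgebraicGeometry.Resolution

universe u

/-! ## Blow-ups are functorial along arbitrary morphisms -/

section ComapMap

variable {X U V : Scheme.{u}}

/-- **The morphism `Bl_{f^*C}(U) ⟶ Bl_C(X)` induced by a morphism `f : U ⟶ X`** (Görtz–Wedhorn I,
Prop. 13.91 (1), for arbitrary `f`): the universal property of `Bl_C(X)` applied to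
`Bl_{f^*C}(U) → U → X`, along which `C` pulls back to the exceptional divisor of `Bl_{f^*C}(U)`,
an effective Cartier divisor. For an open immersion this is `blowup.map`
(`blowup.map_eq_comapMap`). [cite: GortzWedhorn2020, Prop. 13.91 (1)] -/
def blowup.comapMap (C : X.IdealSheafData) (f : U ⟶ X) : blowup (C.comap f) ⟶ blowup C :=
  (blowup.isBlowup C).lift (blowup.π (C.comap f) ≫ f)
    (by
      rw [Scheme.IdealSheafData.comap_comp]
      exact (blowup.isBlowup (C.comap f)).isEffectiveCartier)

/-- The induced morphism lies over `f`. [cite: GortzWedhorn2020, Prop. 13.91 (1)] -/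
@[reassoc (attr := simp)]
theorem blowup.comapMap_π (C : X.IdealSheafData) (f : U ⟶ X) :
    blowup.comapMap C f ≫ blowup.π C = blowup.π (C.comap f) ≫ f :=
  (blowup.isBlowup C).lift_comp _ _

/-- For an open immersion, `blowup.map` is `blowup.comapMap`. [folklore] -/
theorem blowup.map_eq_comapMap (C : X.IdealSheafData) (j : U ⟶ X) [IsOpenImmersion j] :
    blowup.map C j = blowup.comapMap C j := rfl

/-- **Uniqueness of morphisms of blow-ups over `f`**: two morphisms `Bl_{C'}(U) ⟶ Bl_C(X)` lying
over `f : U ⟶ X`, where `C' = f^*C`, coincide. [folklore] -/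
theorem blowup.hom_ext_over {C : X.IdealSheafData} {C' : U.IdealSheafData} {f : U ⟶ X}
    (hC' : C' = C.comap f) {g₁ g₂ : blowup C' ⟶ blowup C} (h₁ : g₁ ≫ blowup.π C = blowup.π C' ≫ f)
    (h₂ : g₂ ≫ blowup.π C = blowup.π C' ≫ f) : g₁ = g₂ := by
  refine (blowup.isBlowup C).hom_ext ?_ (h₁.trans h₂.symm)
  rw [h₁, Scheme.IdealSheafData.comap_comp, ← hC']
  exact (blowup.isBlowup C').isEffectiveCartier

end ComapMap

/-! ## The pulled-back marked ideal `f^*(X, 𝓘, E, μ)` -/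

namespace MarkedIdeal

variable {X U V : Scheme.{u}}

/-- **The pulled-back marked ideal `f^*(X, 𝓘, E, μ) := (U, f^*𝓘, f^*E, μ)`** along a morphism
`f : U ⟶ X` (BGMW Thm. 4.0.6 / 8.0.5: `(X', 𝓘', E', μ) := φ^*(X, 𝓘, E, μ)` for an étale `φ`; the
inverse image ideal sheaves, the boundary divisors pulled back in the same order, the same
multiplicity). [cite: BierstoneGrigorievMilmanWlodarczyk2011, Thm. 8.0.5 (1)–(2)] -/
def comap (M : MarkedIdeal X) (f : U ⟶ X) : MarkedIdeal U where
  ideal := M.ideal.comap f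
  boundary := M.boundary.map fun D => D.comap f
  mult := M.mult

/-- Unfolding. [folklore] -/
@[simp] theorem comap_ideal (M : MarkedIdeal X) (f : U ⟶ X) : (M.comap f).ideal = M.ideal.comap f :=
  rfl

/-- Unfolding. [folklore] -/
@[simp] theorem comap_boundary (M : MarkedIdeal X) (f : U ⟶ X) :
    (M.comap f).boundary = M.boundary.map fun D => D.comap f := rfl

/-- Unfolding. [folklore] -/
@[simp] theorem comap_mult (M : MarkedIdeal X) (f : U ⟶ X) : (M.comap f).mult = M.mult := rfl

/-- Pulling back along the identity. [folklore] -/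
@[simp] theorem comap_id (M : MarkedIdeal X) : M.comap (𝟙 X) = M := by
  obtain ⟨I, E, μ⟩ := M
  simp only [comap, Scheme.IdealSheafData.comap_id, List.map_id']

/-- Pulling back along a composite. [folklore] -/
theorem comap_comp (M : MarkedIdeal X) (f : U ⟶ X) (g : V ⟶ U) :
    M.comap (g ≫ f) = (M.comap f).comap g := by
  obtain ⟨I, E, μ⟩ := M
  simp only [comap, Scheme.IdealSheafData.comap_comp, List.map_map, Function.comp_def]

/-- The support of the pulled-back ideal is the preimage of the support (so is the support of
the pulled-back marked ideal when `μ = 1`). [folklore] -/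
theorem support_comap_of_mult_eq_one (M : MarkedIdeal X) (f : U ⟶ X) (h : M.mult = 1) :
    (M.comap f).support = f ⁻¹' M.support := by
  rw [support_of_mult_eq_one (M.comap f) h, support_of_mult_eq_one M h, comap_ideal,
    Scheme.IdealSheafData.support_comap]
  rfl

end MarkedIdeal

namespace CentreSeq

variable {X U V : Scheme.{u}}

/-! ## The induced sequence along an arbitrary morphism -/

/-- **The induced sequence `f^*(X_i)` of a multiple blow-up along a morphism `f : U ⟶ X`**
(BGMW Thm. 8.0.5 (1)–(2): `φ^*(X_i)` for an étale `φ`; here for any `f`): blow up `U` along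
`f^*C_0`, then pull the rest back along `Bl_{f^*C_0}(U) ⟶ Bl_{C_0}(X)`.
[cite: BierstoneGrigorievMilmanWlodarczyk2011, Thm. 8.0.5 (1)–(2)] -/
def comap : {X U : Scheme.{u}} → CentreSeq X → (U ⟶ X) → CentreSeq U
  | _, U, nil _, _ => nil U
  | _, _, cons C rest, f => cons (C.comap f) (comap rest (blowup.comapMap C f))

/-- Unfolding. [folklore] -/
@[simp] theorem comap_nil (X : Scheme.{u}) (f : U ⟶ X) : (nil X).comap f = nil U := rfl

/-- Unfolding. [folklore] -/
@[simp] theorem comap_cons (C : X.IdealSheafData) (rest : CentreSeq (blowup C)) (f : U ⟶ X) :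
    (cons C rest).comap f = cons (C.comap f) (rest.comap (blowup.comapMap C f)) := rfl

/-- Unfolding. [folklore] -/
@[simp] theorem comap_single (C : X.IdealSheafData) (f : U ⟶ X) :
    (single C).comap f = single (C.comap f) := rfl

/-- The induced sequence has the same length. [folklore] -/
@[simp] theorem length_comap : ∀ {X U : Scheme.{u}} (s : CentreSeq X) (f : U ⟶ X),
    (s.comap f).length = s.length
  | _, _, nil _, _ => rfl
  | _, _, cons C rest, f => by
    simp only [comap_cons, length_cons, length_comap rest (blowup.comapMap C f)]

/-- **Along an open immersion the induced sequence is the restriction** `CentreSeq.restrict`.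
[folklore] -/
theorem restrict_eq_comap : ∀ {X U : Scheme.{u}} (s : CentreSeq X) (j : U ⟶ X)
    [IsOpenImmersion j], s.restrict j = s.comap j
  | _, _, nil _, _, _ => rfl
  | _, _, cons C rest, j, _ => by
    rw [restrict_cons, comap_cons, restrict_eq_comap rest (blowup.map C j)]
    rfl

/-! ## The induced sequence as a relation -/

/-- **`s'` is the sequence induced from `s` along `f`** (`IsPullbackAlong f s s'`): both are
empty, or `s = (C, rest)`, `s' = (C', rest')` with `C' = f^*C` and `rest'` induced from `rest`
along a morphism `Bl_{C'}(U) ⟶ Bl_C(X)` over `f` (necessarily the canonical one,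
`blowup.hom_ext_over`). [cite: BierstoneGrigorievMilmanWlodarczyk2011, Thm. 8.0.5 (1)–(2)] -/
def IsPullbackAlong : {X U : Scheme.{u}} → (U ⟶ X) → CentreSeq X → CentreSeq U → Prop
  | _, _, _, nil _, nil _ => True
  | _, _, _, nil _, cons _ _ => False
  | _, _, _, cons _ _, nil _ => False
  | _, _, f, cons C rest, cons C' rest' => C' = C.comap f ∧
      ∃ g : blowup C' ⟶ blowup C, g ≫ blowup.π C = blowup.π C' ≫ f ∧ IsPullbackAlong g rest rest'

/-- Unfolding. [folklore] -/
@[simp] theorem isPullbackAlong_nil_nil (f : U ⟶ X) : IsPullbackAlong f (nil X) (nil U) := trivial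

/-- Unfolding. [folklore] -/
@[simp] theorem not_isPullbackAlong_nil_cons (f : U ⟶ X) (C' : U.IdealSheafData)
    (rest' : CentreSeq (blowup C')) : ¬ IsPullbackAlong f (nil X) (cons C' rest') := fun h => h

/-- Unfolding. [folklore] -/
@[simp] theorem not_isPullbackAlong_cons_nil (f : U ⟶ X) (C : X.IdealSheafData)
    (rest : CentreSeq (blowup C)) : ¬ IsPullbackAlong f (cons C rest) (nil U) := fun h => h

/-- Unfolding. [folklore] -/
theorem isPullbackAlong_cons_cons (f : U ⟶ X) (C : X.IdealSheafData) (rest : CentreSeq (blowup C))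
    (C' : U.IdealSheafData) (rest' : CentreSeq (blowup C')) :
    IsPullbackAlong f (cons C rest) (cons C' rest') ↔ C' = C.comap f ∧
      ∃ g : blowup C' ⟶ blowup C, g ≫ blowup.π C = blowup.π C' ≫ f ∧
        IsPullbackAlong g rest rest' := Iff.rfl

/-- **Existence**: `s.comap f` is induced from `s` along `f`. [folklore] -/
theorem isPullbackAlong_comap : ∀ {X U : Scheme.{u}} (s : CentreSeq X) (f : U ⟶ X),
    IsPullbackAlong f s (s.comap f)
  | _, _, nil _, _ => trivial
  | _, _, cons C rest, f =>
    ⟨rfl, blowup.comapMap C f, blowup.comapMap_π C f, isPullbackAlong_comap rest _⟩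

/-- The restriction along an open immersion is induced along it. [folklore] -/
theorem isPullbackAlong_restrict (s : CentreSeq X) (j : U ⟶ X) [IsOpenImmersion j] :
    IsPullbackAlong j s (s.restrict j) := by
  rw [restrict_eq_comap]
  exact isPullbackAlong_comap s j

/-- **Uniqueness**: the sequence induced along `f` is unique. [folklore] -/
theorem IsPullbackAlong.unique : ∀ {X U : Scheme.{u}} {f : U ⟶ X} {s : CentreSeq X}
    {s₁ s₂ : CentreSeq U}, IsPullbackAlong f s s₁ → IsPullbackAlong f s s₂ → s₁ = s₂
  | _, _, f, nil _, s₁, s₂, h₁, h₂ => by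
    cases s₁ with
    | nil _ =>
      cases s₂ with
      | nil _ => rfl
      | cons _ _ => exact (h₂ : False).elim
    | cons _ _ => exact (h₁ : False).elim
  | _, _, f, cons C rest, s₁, s₂, h₁, h₂ => by
    cases s₁ with
    | nil _ => exact (h₁ : False).elim
    | cons C₁ rest₁ =>
      cases s₂ with
      | nil _ => exact (h₂ : False).elim
      | cons C₂ rest₂ =>
        obtain ⟨hC₁, g₁, hg₁, hr₁⟩ := h₁
        obtain ⟨hC₂, g₂, hg₂, hr₂⟩ := h₂
        subst hC₁
        subst hC₂
        obtain rfl : g₁ = g₂ := blowup.hom_ext_over rfl hg₁ hg₂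
        rw [IsPullbackAlong.unique hr₁ hr₂]

/-- The induced sequence is `comap`. [folklore] -/
theorem IsPullbackAlong.eq_comap {f : U ⟶ X} {s : CentreSeq X} {s' : CentreSeq U}
    (h : IsPullbackAlong f s s') : s' = s.comap f :=
  h.unique (isPullbackAlong_comap s f)

/-- **Composition**: inducing along `f` and then along `g` induces along `g ≫ f`. [folklore] -/
theorem IsPullbackAlong.comp : ∀ {X U V : Scheme.{u}} {f : U ⟶ X} {g : V ⟶ U} {s : CentreSeq X}
    {s' : CentreSeq U} {s'' : CentreSeq V},
    IsPullbackAlong f s s' → IsPullbackAlong g s' s'' → IsPullbackAlong (g ≫ f) s s''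
  | _, _, _, f, g, nil _, s', s'', h₁, h₂ => by
    cases s' with
    | cons _ _ => exact (h₁ : False).elim
    | nil _ =>
      cases s'' with
      | cons _ _ => exact (h₂ : False).elim
      | nil _ => trivial
  | _, _, _, f, g, cons C rest, s', s'', h₁, h₂ => by
    cases s' with
    | nil _ => exact (h₁ : False).elim
    | cons C' rest' =>
      cases s'' with
      | nil _ => exact (h₂ : False).elim
      | cons C'' rest'' =>
        obtain ⟨hC', a, ha, hr'⟩ := h₁
        obtain ⟨hC'', b, hb, hr''⟩ := h₂
        refine ⟨by rw [hC'', hC', Scheme.IdealSheafData.comap_comp], b ≫ a, ?_,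
          IsPullbackAlong.comp hr' hr''⟩
        rw [Category.assoc, ha, reassoc_of% hb]

/-- A sequence is induced from itself along the identity. [folklore] -/
theorem isPullbackAlong_id : ∀ {X : Scheme.{u}} (s : CentreSeq X), IsPullbackAlong (𝟙 X) s s
  | _, nil _ => trivial
  | _, cons C rest =>
    ⟨(Scheme.IdealSheafData.comap_id C).symm, 𝟙 _, by simp, isPullbackAlong_id rest⟩

/-- **`s^*(g ≫ f) = (s^*f)^*g`**: the induced sequence along a composite. [folklore] -/
theorem comap_comp (s : CentreSeq X) (f : U ⟶ X) (g : V ⟶ U) :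
    s.comap (g ≫ f) = (s.comap f).comap g :=
  (((isPullbackAlong_comap s f).comp (isPullbackAlong_comap (s.comap f) g)).eq_comap).symm

/-- The induced sequence along the identity. [folklore] -/
@[simp] theorem comap_id (s : CentreSeq X) : s.comap (𝟙 X) = s :=
  ((isPullbackAlong_id s).eq_comap).symm

/-- Pulling back along an isomorphism and its inverse returns the sequence. [folklore] -/
theorem comap_comap_of_comp_eq_id {f : U ⟶ X} {g : X ⟶ U} (h : g ≫ f = 𝟙 X) (s : CentreSeq X) :
    (s.comap f).comap g = s := by
  rw [← comap_comp, h, comap_id]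

/-! ## Extensions of multiple blow-ups (BGMW Def. 3.1.5) -/

/-- **`s` is an extension of the multiple blow-up `t`** (BGMW Def. 3.1.5: "a sequence
`(X'_j)_{0≤j≤m'}` of blow-ups and isomorphisms
`X'_0 = X'_{j_0} = … = X'_{j_1-1} ← X'_{j_1} = … ← … X'_{j_m} = … = X'_{m'}`, where `X'_{j_i} = X_i`"):
`s` is `t` with trivial steps (blow-ups along the unit ideal sheaf — isomorphisms, Def. 3.1.4)
interspersed; after a trivial step of `s`, `t` is compared after pulling it back along the
isomorphism `Bl_∅ → X`. [cite: BierstoneGrigorievMilmanWlodarczyk2011, Def. 3.1.5] -/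
def IsExtensionOf : {X : Scheme.{u}} → CentreSeq X → CentreSeq X → Prop
  | _, nil _, t => t = nil _
  | _, cons C rest, t =>
      (∃ rest' : CentreSeq (blowup C), t = cons C rest' ∧ rest.IsExtensionOf rest') ∨
        (C = ⊤ ∧ rest.IsExtensionOf (t.comap (blowup.π C)))

/-- Unfolding. [folklore] -/
@[simp] theorem nil_isExtensionOf_iff (t : CentreSeq X) : (nil X).IsExtensionOf t ↔ t = nil X :=
  Iff.rfl

/-- Unfolding. [folklore] -/
theorem cons_isExtensionOf_iff (C : X.IdealSheafData) (rest : CentreSeq (blowup C))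
    (t : CentreSeq X) : (cons C rest).IsExtensionOf t ↔
      (∃ rest' : CentreSeq (blowup C), t = cons C rest' ∧ rest.IsExtensionOf rest') ∨
        (C = ⊤ ∧ rest.IsExtensionOf (t.comap (blowup.π C))) := Iff.rfl

/-- Matching a step: `cons C rest` extends `cons C rest'` as soon as `rest` extends `rest'`.
[folklore] -/
theorem IsExtensionOf.cons_cons {C : X.IdealSheafData} {rest rest' : CentreSeq (blowup C)}
    (h : rest.IsExtensionOf rest') : (cons C rest).IsExtensionOf (cons C rest') :=
  Or.inl ⟨rest', rfl, h⟩

/-- Inserting a trivial step. [folklore] -/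
theorem IsExtensionOf.cons_top {rest : CentreSeq (blowup (⊤ : X.IdealSheafData))} {t : CentreSeq X}
    (h : rest.IsExtensionOf (t.comap (blowup.π ⊤))) : (cons ⊤ rest).IsExtensionOf t :=
  Or.inr ⟨rfl, h⟩

/-- **Reflexivity**: every sequence is an extension of itself.
[cite: BierstoneGrigorievMilmanWlodarczyk2011, Def. 3.1.5] -/
theorem IsExtensionOf.refl : ∀ {X : Scheme.{u}} (s : CentreSeq X), s.IsExtensionOf s
  | _, nil _ => rfl
  | _, cons _ rest => Or.inl ⟨rest, rfl, IsExtensionOf.refl rest⟩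

/-- Non-vacuity beyond reflexivity: a trivial step followed by (the pull-back of) `t` is an
extension of `t`. [folklore] -/
theorem isExtensionOf_cons_top_comap (t : CentreSeq X) :
    (cons ⊤ (t.comap (blowup.π ⊤))).IsExtensionOf t :=
  IsExtensionOf.cons_top (IsExtensionOf.refl _)

/-- **The extensions of the empty sequence are the sequences of trivial steps.** [folklore] -/
theorem isExtensionOf_nil_iff : ∀ {X : Scheme.{u}} (s : CentreSeq X),
    s.IsExtensionOf (nil X) ↔ s.AllTrivial
  | _, nil _ => by simp
  | _, cons C rest => by
    rw [cons_isExtensionOf_iff, allTrivial_cons, comap_nil, isExtensionOf_nil_iff rest]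
    constructor
    · rintro (⟨_, h, -⟩ | h)
      · cases h
      · exact h
    · exact Or.inr

/-- **Consistency with `IsExtensionOfSingle`**: `s` extends the one-step sequence along `J`
(Def. 3.1.5 with `m = 1`) iff `s.IsExtensionOfSingle J` (`CanonicalResolution.lean`).
[cite: BierstoneGrigorievMilmanWlodarczyk2011, Def. 3.1.5] -/
theorem isExtensionOf_single_iff : ∀ {X : Scheme.{u}} (s : CentreSeq X) (J : X.IdealSheafData),
    s.IsExtensionOf (single J) ↔ s.IsExtensionOfSingle J
  | _, nil _, J => by
    simp only [nil_isExtensionOf_iff, not_isExtensionOfSingle_nil, iff_false]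
    intro h
    cases h
  | _, cons C rest, J => by
    rw [cons_isExtensionOf_iff, isExtensionOfSingle_cons, comap_single,
      isExtensionOf_single_iff rest]
    refine or_congr ?_ Iff.rfl
    constructor
    · rintro ⟨rest', h, hr⟩
      -- `single J = cons C rest'` forces `C = J` and `rest' = nil`
      change cons J (nil _) = cons C rest' at h
      injection h with _ hJC hrest
      subst hJC
      obtain rfl : nil _ = rest' := eq_of_heq hrest
      exact ⟨rfl, (isExtensionOf_nil_iff rest).mp hr⟩
    · rintro ⟨rfl, hr⟩
      exact ⟨nil _, rfl, (isExtensionOf_nil_iff rest).mpr hr⟩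

/-- **Extensions pull back to extensions** along any morphism (BGMW Def. 3.1.5, Remark (1):
"The definition of extension arises naturally when we pass to open subsets of the ambient
variety"; also the form in which Thm. 8.0.5 (2) is iterated).
[cite: BierstoneGrigorievMilmanWlodarczyk2011, Def. 3.1.5 Remark (1)] -/
theorem IsExtensionOf.comap : ∀ {X U : Scheme.{u}} {s t : CentreSeq X} (f : U ⟶ X),
    s.IsExtensionOf t → (s.comap f).IsExtensionOf (t.comap f)
  | _, _, nil _, t, f, h => by
    rw [nil_isExtensionOf_iff] at h
    subst h
    rfl
  | _, _, cons C rest, t, f, h => by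
    rcases h with ⟨rest', rfl, hr⟩ | ⟨hC, hr⟩
    · exact Or.inl ⟨rest'.comap (blowup.comapMap C f), rfl, hr.comap _⟩
    · refine Or.inr ⟨by rw [hC, Scheme.IdealSheafData.comap_top], ?_⟩
      have ih := hr.comap (blowup.comapMap C f)
      rw [← comap_comp, blowup.comapMap_π, comap_comp] at ih
      exact ih

/-- Extensions restrict to extensions along open immersions.
[cite: BierstoneGrigorievMilmanWlodarczyk2011, Def. 3.1.5 Remark (1)] -/
theorem IsExtensionOf.restrict {s t : CentreSeq X} (j : U ⟶ X) [IsOpenImmersion j]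
    (h : s.IsExtensionOf t) : (s.restrict j).IsExtensionOf (t.restrict j) := by
  rw [restrict_eq_comap, restrict_eq_comap]
  exact h.comap j

/-- **Transitivity**: an extension of an extension of `t` is an extension of `t`.
[cite: BierstoneGrigorievMilmanWlodarczyk2011, Def. 3.1.5] -/
theorem IsExtensionOf.trans : ∀ {X : Scheme.{u}} {r s t : CentreSeq X},
    r.IsExtensionOf s → s.IsExtensionOf t → r.IsExtensionOf t
  | _, nil _, s, t, hrs, hst => by
    rw [nil_isExtensionOf_iff] at hrs
    subst hrs
    exact hst
  | _, cons C r₁, s, t, hrs, hst => by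
    rcases hrs with ⟨s₁, rfl, h₁⟩ | ⟨hC, h₁⟩
    · rcases hst with ⟨t₁, rfl, h₂⟩ | ⟨hC, h₂⟩
      · exact Or.inl ⟨t₁, rfl, h₁.trans h₂⟩
      · exact Or.inr ⟨hC, h₁.trans h₂⟩
    · exact Or.inr ⟨hC, h₁.trans (hst.comap (blowup.π C))⟩

/-- **An extension of an extension of the one-step sequence along `J` is an extension of it** —
the composition by which clause (ii) of `BierstoneGrigorievMilmanWlodarczyk2011_canonical`
follows from Thm. 8.0.5 (2) (`s|U` extends the canonical resolution of `(U, 𝓘|U, ∅, 1)`) and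
the value of the canonical resolution on a smooth irreducible centre (an extension of — indeed
equal to — the single blow-up). [cite: BierstoneGrigorievMilmanWlodarczyk2011, Thm. 8.0.5 (2) with Def. 3.1.5] -/
theorem IsExtensionOf.isExtensionOfSingle {s t : CentreSeq X} {J : X.IdealSheafData}
    (h : s.IsExtensionOf t) (ht : t.IsExtensionOfSingle J) : s.IsExtensionOfSingle J :=
  (isExtensionOf_single_iff s J).mp (h.trans ((isExtensionOf_single_iff t J).mpr ht))

/-- An extension has at least the length of the sequence it extends. [folklore] -/
theorem IsExtensionOf.length_le : ∀ {X : Scheme.{u}} {s t : CentreSeq X},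
    s.IsExtensionOf t → t.length ≤ s.length
  | _, nil _, t, h => by
    rw [nil_isExtensionOf_iff] at h
    subst h
    exact le_rfl
  | _, cons C rest, t, h => by
    rcases h with ⟨rest', rfl, hr⟩ | ⟨-, hr⟩
    · simpa using hr.length_le
    · have := hr.length_le
      rw [length_comap] at this
      rw [length_cons]
      omega

end CentreSeq

end Literature.AlgebraicGeometry.Resolution

end
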